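import Literature.MathematicalPhysics.QuantumFieldTheory.Balaban1983to89.Beta.RemainderKernelGreenCoercive

/-!
# SYMMETRIC (second-order) COMBES–THOMAS: for a SYMMETRIC coercive kernel the decay rate of the Green's function is
# governed by `cosh(κ|x−y|₁) − 1 = O(κ²)`-weighted row sums, not by `e^{κ|x−y|₁} − 1 = O(κ)` — the rate scales like the
# SQUARE ROOT of the coercivity constant (`Beta.RemainderKernelGreenSymm`)

statement-level skeleton of published theorems with citation tags; proofs where landed; nothing here is a claim
about the Yang–Mills mass gap.

HONEST FRAMING (cell rule).  Bookkeeping for the k-uniform remainder chain of row (D4) (`RemainderConst` ⇐ ONE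
`ChainTFac190` instance, `Beta.RemainderDecay190`); discharges NOTHING of `BetaPertH`; NOT B12 Thm 2, NOT the continuum
limit, NOT Clay.  Unit `b2b-balaban-beta-an4` gen 100 (BINDER row D4 OWNER; cell pub-balaban).  Imports
`Beta.RemainderKernelGreenCoercive` (gen 98: boxes, extended box inverses, `compKer_extend_inv`, the compactness limit) and
through it `QGQInverse` (reader r1: `Coercive`, `conj`, `inv_entry_le_of_conj_coercive`, `coercive_of_form_perturbation`,
`form_abs_le_of_schur`) and `EntrywiseVolumeLimit` (gen 9: the kernel letters) ONLY, all BY NAME.  [folklore] — the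
Combes–Thomas ∕ Agmon weighted-conjugation argument in its symmetric (quadratic-form) version; no new idea.  THE SAME
MECHANISM IS ALREADY IN THE TREE in the an2 ∕ pv23 currency: `Beta.CombesThomasForm.combesThomas_lap_add_blocks` ∕
`combesThomas_lattice` (`H = lap c + Σ_b m_b u_b ⊗ u_b`, one column `Hv = e_{k₀}`) and its torus instance
`Beta.TorusG0Decay.setDecay_torus` (`ℓ²` set-to-set decay of `(−Δ^η + aQ*Q)⁻¹` on the torus type, `η`-free smallness
`2dδ² + a(e^δ − 1) ≤ min(2,a)∕2`); and the PRINTED statement itself — [5] Prop. 1.2 (1.110)–(1.111) with sup-norm `O(1)`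
prefactors, `K`- and volume-uniform — is in the tree for the genuine `G′_K` on the one-scale TORUS FAMILY, hypothesis-free, by
[Balaban1983RegularityDecay]'s route (lit-balaban p01, `B6Prop22OneScaleTorus.entries_oneScaleTorus`).  What THIS file adds is
only the statement in r1's `Coercive` ∕ `conj` currency for principal submatrices of `ℤ^d` KERNELS, wired into gen 98's
two-sided INFINITE-VOLUME Green's-function limit (`compKer`, `Decay₂`, `IsPeriodic₂` — the letters the row-(D4) model road and
`EntrywiseVolumeLimit` §4 consume); nothing is re-proved from those files and nothing of theirs is restated.

WHY.  Gens 97–99 produced the `ℤ^d` Green's functions of Bałaban's one-step operators by r1's finite Combes–Thomas theorem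
`QGQInverse.inverse_decay`, whose smallness parameter is the `(e^{κ|x−y|₁} − 1)`-weighted absolute row sum — FIRST order in
`κ`.  For `T = −Δ + aQ*Q` with blocks of side `L` the coercivity constant is `≍ L^{−2}` (blockwise Poincaré,
`RemainderKernelBlockAveraging.coercive_blockAvg`) while the first-order weighted row sum of `−Δ` is `≍ κ`, so that road
yields a rate `κ ≍ L^{−2}` per lattice step, i.e. `≍ L^{−1}` PER BLOCK — it degrades with the block side, whereas [5]
Prop. 1.2 (1.110) has `e^{−δ₀|y−y′|}` in block units with `δ₀` depending on `d` only.  The loss is an artefact: for a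
SYMMETRIC real matrix `S` and a real weight `f`, the real quadratic form of the conjugated matrix `e^{f} S e^{−f}` only sees
the SYMMETRIC part `cosh(f_i − f_j) S_{ij}` — the antisymmetric first-order part `sinh(f_i − f_j) S_{ij}` drops out — so
coercivity survives whenever the `(cosh(f_i − f_j) − 1)`-weighted row sums are small, which is SECOND order in the rate.
For `−Δ + aQ*Q` this gives `κ ≍ L^{−1}` per lattice step = a rate PER BLOCK INDEPENDENT OF `L` (the companion
`Beta.RemainderKernelGreenUniform`, staged behind `RemainderKernelBlockAveraging`'s build).  This is the route [5] p. 36 names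
and does not take: *«Probably the simplest proof of the exponential decay properties can be obtained by relating G on the
torus to G on the whole lattice ηZ^d in the usual way, and then proving that the operator e^{−⟨q,x⟩}Δ_a e^{⟨q,x⟩} − Δ_a is a
small perturbation of Δ_a for vectors q ∈ R^d sufficiently small. Instead we construct a random walk representation …»*.

* §1  ABSTRACT (finite real matrices): `form_conj_of_isSymm` (`⟨x, S_f x⟩ = Σ cosh(f_i − f_j) S_{ij} x_i x_j`),
  **`coercive_conj_of_isSymm`** (`S` symmetric `γ`-coercive, `(cosh(f_i−f_j) − 1)`-weighted absolute row sums `≤ ρ` ⟹ `S_f`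
  is `(γ − ρ)`-coercive), **`inverse_decay_symm`** (pseudo-metric `d`, `(cosh(κd) − 1)`-weighted row sums `≤ ρ < γ` ⟹
  `|S⁻¹(i,j)| ≤ (γ − ρ)⁻¹ e^{−κ d(i,j)}`) — r1's `inverse_decay` with `e^{κd} − 1` replaced by `cosh(κd) − 1`; the
  conjugation algebra `conj_mul_conj` ∕ `conj_one` ∕ `conj_conj` ∕ `conj_zero` ∕ `conj_inv_eq` (`(S_f)⁻¹ = (S⁻¹)_f`) and the
  BILINEAR (operator-norm) form **`abs_dot_conj_inv_mulVec_le`** (`|⟨u, (S⁻¹)_f v⟩| ≤ γ⁻¹‖u‖‖v‖` when `S_f` is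
  `γ`-coercive) through which block sums of a Green's function are read with `L`-free prefactors.
* §2  ONE FINITE VOLUME on `ℤ^d`: **`abs_restrict_inv_le_symm`** ∕ `abs_extend_inv_le_symm` — for a symmetric kernel `T`
  whose principal submatrix on `s` is `γ`-coercive and whose `(cosh(κ|x−y|₁) − 1)`-weighted absolute row sums are `≤ ρ < γ`:
  `|T_s⁻¹(i,j)| ≤ (γ − ρ)⁻¹ e^{−κ|i−j|₁}`, constants free of `s`.
* §3  THE MECHANISM SEPARATED FROM THE ESTIMATE: **`exists_green_of_invBound_exhaustion(_tendsto)`** — finite range,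
  `γ`-coercive principal submatrices along an exhaustion (invertibility only) and ANY uniform bound `|T_s⁻¹(i,j)| ≤
  C e^{−δ|i−j|₁}` on the boxes ⟹ `∃ S, T ∘ S = δ = S ∘ T ∧ Decay₂ S C δ` (gen 98's Tychonoff argument, verbatim, with the
  bound as a hypothesis; the `_tendsto` form also exports the subsequence of boxes and the entrywise convergence of their
  extended inverses to `S`, so that further finite-sum bounds transfer);
  hence **`exists_green_of_coercive_symm_exhaustion`** ∕ **`exists_green_of_coercive_symm`** (cubes) ∕
  **`exists_green_of_coercive_symm_periodic`** (`κ > 0` + a row bound ⟹ jointly `n`-periodic for every period `n` of `T`).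
WHAT IS *NOT* DONE: no operator of Bałaban's is touched in THIS file (the block-averaging instance is the companion); the
sup-norm `O(1)` prefactor of [5] (1.110) ∕ (1.115) (local regularity, [5] Prop. 1.1 (1.89)) is out of reach of the energy
method and is NOT claimed anywhere on this road; covariant ∕ multi-level operators, the averaging-constrained `G̃` of [15]:
untouched; row D4 class UNCHANGED (instance 0∕1; critical-path width 0 = NODE O; D4 DISCHARGE NO DATE).  No `def`, no named
fact, no `sorry`, standard axioms.
HONEST DEPENDENCY: continuum YM on T⁴ ⇐ BetaPertH ∧ nine spine estimates (0/9 proved); BetaPertH ⇐ (D1) ∧ (D4) ∧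
CAP+tail; G-an2-4 gates asym, D1 and NE2/3/4.

Sources: J.-M. Combes, L. Thomas, Commun. Math. Phys. **34** (1973) 251–270 [CombesThomas1973], §II (weighted conjugation);
[5] = T. Bałaban, Commun. Math. Phys. **95** (1984) 17–40 [Balaban1984PropagatorsI], Prop. 1.2 (1.110) p. 35 and the
remark p. 36 quoted above; [3] = Commun. Math. Phys. **96** (1984) 223–250 [Balaban1984PropagatorsII], Lemma 2.1 p. 234
(exponential bookkeeping on `ℤ^d`).
-/

namespace Literature.MathematicalPhysics.QuantumFieldTheory.Balaban1983to89.Beta.RemainderKernelGreenSymm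

open Matrix Finset
open Literature.MathematicalPhysics.QuantumFieldTheory.Balaban1983to89
open Literature.MathematicalPhysics.QuantumFieldTheory.Balaban1983to89.B12Sec2to5 (l1 l1_nonneg abs_coord_le_l1)
open Literature.MathematicalPhysics.QuantumFieldTheory.Balaban1983to89.B12Decay510Window (l1_sub_triangle l1_sub_comm)
open Literature.MathematicalPhysics.QuantumFieldTheory.Balaban1983to89.Beta
  (Kernel₂ Decay₂ IsPeriodic₂ RowBound HasRange compKer kdelta)
open Literature.MathematicalPhysics.QuantumFieldTheory.Balaban1983to89.QGQInverse (Coercive conj conj_apply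
  isUnit_of_coercive inv_mulVec_sq_le inv_entry_le_of_conj_coercive coercive_of_form_perturbation form_abs_le_of_schur)
open Literature.MathematicalPhysics.QuantumFieldTheory.Balaban1983to89.Beta.RemainderKernelGreenCoercive
  (eventually_mem_cube compKer_eq_sum_left compKer_eq_sum_right compKer_extend_inv compKer_extend_inv')
open _root_.Filter
open scoped _root_.Topology

/-! ## §1. Symmetric Combes–Thomas for finite real matrices -/

section Abstract

variable {n : Type*} [Fintype n]

/-- The real quadratic form of the conjugated matrix `S_f = e^{f} S e^{−f}` of a SYMMETRIC `S`: only `cosh` of the weight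
differences enters, `⟨x, S_f x⟩ = Σ_{i,j} cosh(f_i − f_j) S_{ij} x_i x_j` (the `sinh` part is antisymmetric and drops out).
[cite: CombesThomas1973, §II] [folklore] -/
theorem form_conj_of_isSymm {S : Matrix n n ℝ} (hS : S.IsSymm) (f : n → ℝ) (x : n → ℝ) :
    x ⬝ᵥ (conj f S *ᵥ x) = ∑ i, ∑ j, Real.cosh (f i - f j) * S i j * x i * x j := by
  have e1 : x ⬝ᵥ (conj f S *ᵥ x) = ∑ i, ∑ j, Real.exp (f i - f j) * S i j * x i * x j := by
    simp only [dotProduct, Matrix.mulVec, conj_apply, Finset.mul_sum]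
    exact Finset.sum_congr rfl fun i _ => Finset.sum_congr rfl fun j _ => by ring
  have e2 : ∑ i, ∑ j, Real.exp (f i - f j) * S i j * x i * x j
      = ∑ i, ∑ j, Real.exp (f j - f i) * S i j * x i * x j := by
    rw [Finset.sum_comm]
    exact Finset.sum_congr rfl fun i _ => Finset.sum_congr rfl fun j _ => by
      rw [show S j i = S i j from hS.apply i j]; ring
  have e3 : 2 * (x ⬝ᵥ (conj f S *ᵥ x)) = 2 * ∑ i, ∑ j, Real.cosh (f i - f j) * S i j * x i * x j := by
    rw [two_mul, Finset.mul_sum]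
    nth_rewrite 1 [e1]; rw [e1]
    nth_rewrite 2 [e2]
    rw [← Finset.sum_add_distrib]
    refine Finset.sum_congr rfl fun i _ => ?_
    rw [Finset.mul_sum, ← Finset.sum_add_distrib]
    refine Finset.sum_congr rfl fun j _ => ?_
    rw [Real.cosh_eq, show f j - f i = -(f i - f j) by ring]
    ring
  linarith

/-- … hence the conjugated form differs from the form of `S` by the `(cosh(f_i − f_j) − 1) S_{ij}`-form.
[cite: CombesThomas1973, §II] [folklore] -/
theorem form_conj_sub_of_isSymm {S : Matrix n n ℝ} (hS : S.IsSymm) (f : n → ℝ) (x : n → ℝ) :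
    x ⬝ᵥ ((conj f S - S) *ᵥ x) = ∑ i, ∑ j, (Real.cosh (f i - f j) - 1) * S i j * x i * x j := by
  rw [Matrix.sub_mulVec, dotProduct_sub, form_conj_of_isSymm hS]
  have e : x ⬝ᵥ (S *ᵥ x) = ∑ i, ∑ j, S i j * x i * x j := by
    simp only [dotProduct, Matrix.mulVec, Finset.mul_sum]
    exact Finset.sum_congr rfl fun i _ => Finset.sum_congr rfl fun j _ => by ring
  rw [e, ← Finset.sum_sub_distrib]
  refine Finset.sum_congr rfl fun i _ => ?_
  rw [← Finset.sum_sub_distrib]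
  exact Finset.sum_congr rfl fun j _ => by ring

/-- **SYMMETRIC COMBES–THOMAS, COERCIVITY STEP.**  `S` symmetric and `γ`-coercive, `f` any real weight: if the
`(cosh(f_i − f_j) − 1)`-weighted absolute ROW sums of `S` are `≤ ρ` then `S_f = e^{f} S e^{−f}` is `(γ − ρ)`-coercive
(the column sums equal the row sums by symmetry; finite Schur test on the `(cosh − 1) S`-form).
[cite: CombesThomas1973, §II] [folklore] -/
theorem coercive_conj_of_isSymm {S : Matrix n n ℝ} {f : n → ℝ} {γ ρ : ℝ} (hS : S.IsSymm) (hco : Coercive S γ)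
    (hrow : ∀ i, ∑ j, |S i j| * (Real.cosh (f i - f j) - 1) ≤ ρ) : Coercive (conj f S) (γ - ρ) := by
  rcases isEmpty_or_nonempty n with hn | ⟨⟨i₀⟩⟩
  · intro x
    simp [dotProduct]
  have hρ : 0 ≤ ρ := by
    refine le_trans (Finset.sum_nonneg fun j _ => mul_nonneg (abs_nonneg _) ?_) (hrow i₀)
    linarith [Real.one_le_cosh (f i₀ - f j)]
  refine coercive_of_form_perturbation hco fun x => ?_
  set E : Matrix n n ℝ := Matrix.of fun i j => (Real.cosh (f i - f j) - 1) * S i j with hE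
  have hform : x ⬝ᵥ ((conj f S - S) *ᵥ x) = x ⬝ᵥ (E *ᵥ x) := by
    rw [form_conj_sub_of_isSymm hS]
    simp only [dotProduct, Matrix.mulVec, hE, Matrix.of_apply, Finset.mul_sum]
    exact Finset.sum_congr rfl fun i _ => Finset.sum_congr rfl fun j _ => by ring
  have habs : ∀ i j, |E i j| = |S i j| * (Real.cosh (f i - f j) - 1) := by
    intro i j
    simp only [hE, Matrix.of_apply, abs_mul]
    rw [abs_of_nonneg (by linarith [Real.one_le_cosh (f i - f j)])]; ring
  rw [hform]
  refine form_abs_le_of_schur E hρ (by rw [pow_two]) (fun i => ?_) (fun j => ?_) x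
  · simp only [habs]; exact hrow i
  · simp only [habs]
    have e : ∀ i, |S i j| * (Real.cosh (f i - f j) - 1) = |S j i| * (Real.cosh (f j - f i) - 1) := by
      intro i
      rw [show S j i = S i j from hS.apply i j, show f j - f i = -(f i - f j) by ring, Real.cosh_neg]
    simp only [e]; exact hrow j

/-- **LIPSCHITZ WEIGHTS.**  `S` symmetric `γ`-coercive, `d` symmetric with the triangle inequality, `κ ≥ 0`, the
`(cosh(κ d(i,j)) − 1)`-weighted absolute row sums `≤ ρ`, and `f` any weight with `|f_i − f_j| ≤ κ d(i,j)`: then `S_f` is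
`(γ − ρ)`-coercive (`cosh` is even and increasing in `|·|`; `κ ≥ 0` is implied).  The freedom in `f` (distance to a point,
to a set, capped distances …) is what the consumers use. [cite: CombesThomas1973, §II] [folklore] -/
theorem coercive_conj_of_lipschitz {S : Matrix n n ℝ} (d : n → n → ℝ) {f : n → ℝ} {γ κ ρ : ℝ} (hS : S.IsSymm)
    (hco : Coercive S γ) (hlip : ∀ a b, |f a - f b| ≤ κ * d a b)
    (hrow : ∀ i, ∑ j, |S i j| * (Real.cosh (κ * d i j) - 1) ≤ ρ) : Coercive (conj f S) (γ - ρ) := by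
  refine coercive_conj_of_isSymm hS hco fun a => le_trans (Finset.sum_le_sum fun b _ => ?_) (hrow a)
  refine mul_le_mul_of_nonneg_left ?_ (abs_nonneg _)
  have h0 : 0 ≤ κ * d a b := le_trans (abs_nonneg _) (hlip a b)
  have h1 : Real.cosh (f a - f b) = Real.cosh |f a - f b| := (Real.cosh_abs _).symm
  have h2 : Real.cosh |f a - f b| ≤ Real.cosh (κ * d a b) := by
    rw [Real.cosh_le_cosh, abs_abs, abs_of_nonneg h0]
    exact hlip a b
  linarith

/-- **SYMMETRIC COMBES–THOMAS, DECAY OF THE INVERSE — SECOND ORDER IN THE RATE.**  `S` symmetric and `γ`-coercive, `d` a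
pseudo-metric (symmetric, zero diagonal, triangle inequality), `κ ≥ 0`, and the `(cosh(κ d(i,j)) − 1)`-weighted absolute row
sums `≤ ρ < γ`: then `|S⁻¹(i,j)| ≤ (γ − ρ)⁻¹ e^{−κ d(i,j)}`.  Compared with r1's `QGQInverse.inverse_decay` the weight
`e^{κd} − 1 = O(κ)` is replaced by `cosh(κd) − 1 = O(κ²)`: the admissible rate scales like the square root of the gap.
[cite: CombesThomas1973, §II] [folklore] -/
theorem inverse_decay_symm [DecidableEq n] (S : Matrix n n ℝ) (d : n → n → ℝ) {γ κ ρ : ℝ} (hS : S.IsSymm)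
    (hργ : ρ < γ) (hκ : 0 ≤ κ) (hco : Coercive S γ)
    (hd_symm : ∀ i j, d i j = d j i) (hd_zero : ∀ i, d i i = 0)
    (hd_tri : ∀ i j k, d i k ≤ d i j + d j k)
    (hrow : ∀ i, ∑ j, |S i j| * (Real.cosh (κ * d i j) - 1) ≤ ρ) (i j : n) :
    |S⁻¹ i j| ≤ (γ - ρ)⁻¹ * Real.exp (-(κ * d i j)) := by
  set f : n → ℝ := fun a => κ * d a j with hf
  have hlip : ∀ a b, |f a - f b| ≤ κ * d a b := by
    intro a b
    simp only [hf]
    rw [← mul_sub, abs_mul, abs_of_nonneg hκ]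
    refine mul_le_mul_of_nonneg_left (abs_sub_le_iff.2 ⟨?_, ?_⟩) hκ
    · linarith [hd_tri a b j]
    · linarith [hd_tri b a j, hd_symm a b]
  have hc : Coercive (conj f S) (γ - ρ) := coercive_conj_of_lipschitz d hS hco hlip hrow
  have h := inv_entry_le_of_conj_coercive (by linarith) hc i j
  simpa [hf, hd_zero] using h

/-- The conjugated matrices multiply like the matrices: `S_f · M_f = (S·M)_f`. [cite: CombesThomas1973, §II] [folklore] -/
theorem conj_mul_conj [DecidableEq n] (f : n → ℝ) (S M : Matrix n n ℝ) : conj f S * conj f M = conj f (S * M) := by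
  ext i k
  simp only [Matrix.mul_apply, conj_apply, Finset.mul_sum]
  refine Finset.sum_congr rfl fun j _ => ?_
  have e : Real.exp (f i - f j) * Real.exp (f j - f k) = Real.exp (f i - f k) := by
    rw [← Real.exp_add]; ring_nf
  calc Real.exp (f i - f j) * S i j * (Real.exp (f j - f k) * M j k)
      = Real.exp (f i - f j) * Real.exp (f j - f k) * (S i j * M j k) := by ring
    _ = Real.exp (f i - f k) * (S i j * M j k) := by rw [e]

omit [Fintype n] in
/-- `1_f = 1`. [cite: CombesThomas1973, §II] [folklore] -/
theorem conj_one [DecidableEq n] (f : n → ℝ) : conj f (1 : Matrix n n ℝ) = 1 := by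
  ext i k
  by_cases hik : i = k
  · subst hik; simp [conj_apply]
  · simp [conj_apply, Matrix.one_apply_ne hik]

omit [Fintype n] in
/-- Iterated conjugation adds the weights: `(S_f)_g = S_{g+f}`. [cite: CombesThomas1973, §II] [folklore] -/
theorem conj_conj (f g : n → ℝ) (S : Matrix n n ℝ) : conj g (conj f S) = conj (g + f) S := by
  ext i k
  simp only [conj_apply, Pi.add_apply]
  rw [← mul_assoc, ← Real.exp_add]
  ring_nf

omit [Fintype n] in
/-- `S_0 = S`. [cite: CombesThomas1973, §II] [folklore] -/
theorem conj_zero (S : Matrix n n ℝ) : conj 0 S = S := by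
  ext i k; simp [conj_apply]

/-- The inverse of the conjugated matrix is the conjugated inverse: `(S_f)⁻¹ = (S⁻¹)_f` (when `S_f` is invertible; then so
is `S = (S_f)_{−f}`). [cite: CombesThomas1973, §II] [folklore] -/
theorem conj_inv_eq [DecidableEq n] (f : n → ℝ) {S : Matrix n n ℝ} (hU : IsUnit (conj f S).det) :
    (conj f S)⁻¹ = conj f S⁻¹ := by
  have hSinv : S⁻¹ = conj (-f) (conj f S)⁻¹ := by
    refine Matrix.inv_eq_right_inv ?_
    calc S * conj (-f) (conj f S)⁻¹ = conj (-f) (conj f S) * conj (-f) (conj f S)⁻¹ := by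
          rw [conj_conj, neg_add_cancel, conj_zero]
      _ = conj (-f) (conj f S * (conj f S)⁻¹) := conj_mul_conj _ _ _
      _ = 1 := by rw [Matrix.mul_nonsing_inv _ hU, conj_one]
  rw [hSinv, conj_conj, add_neg_cancel, conj_zero]

/-- **BILINEAR (operator-norm) FORM OF THE CONJUGATED-INVERSE BOUND.**  If `S_f` is `γ`-coercive (`γ > 0`) then for all
test vectors `u, v`: `|Σ_{i,j} u_i e^{f_i − f_j} S⁻¹_{ij} v_j| ≤ γ⁻¹ ‖u‖ ‖v‖` — the whole operator `e^{f}S⁻¹e^{−f}` has norm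
`≤ γ⁻¹`, not only its entries (r1's `inv_mulVec_sq_le` + Cauchy–Schwarz).  Block sums of the Green's function are read
through this with indicator-type `u, v`. [cite: CombesThomas1973, §II] [folklore] -/
theorem abs_dot_conj_inv_mulVec_le [DecidableEq n] {S : Matrix n n ℝ} {f : n → ℝ} {γ : ℝ} (hγ : 0 < γ)
    (h : Coercive (conj f S) γ) (u v : n → ℝ) :
    |u ⬝ᵥ (conj f S⁻¹ *ᵥ v)| ≤ γ⁻¹ * Real.sqrt (u ⬝ᵥ u) * Real.sqrt (v ⬝ᵥ v) := by
  have hU : IsUnit (conj f S).det := (Matrix.isUnit_iff_isUnit_det _).mp (isUnit_of_coercive hγ h)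
  rw [← conj_inv_eq f hU]
  set w := (conj f S)⁻¹ *ᵥ v with hw
  have hw2 : γ ^ 2 * (w ⬝ᵥ w) ≤ v ⬝ᵥ v := inv_mulVec_sq_le hγ h v
  have huu : 0 ≤ u ⬝ᵥ u := Literature.LinearAlgebra.Matrix.dotProduct_self_nonneg_real u
  have hvv : 0 ≤ v ⬝ᵥ v := Literature.LinearAlgebra.Matrix.dotProduct_self_nonneg_real v
  have hww : 0 ≤ w ⬝ᵥ w := Literature.LinearAlgebra.Matrix.dotProduct_self_nonneg_real w
  have hcs : (u ⬝ᵥ w) ^ 2 ≤ (u ⬝ᵥ u) * (w ⬝ᵥ w) := B9Thm311.dot_sq_le u w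
  -- `|u⬝w| ≤ √(u⬝u) √(w⬝w)` and `√(w⬝w) ≤ γ⁻¹ √(v⬝v)`
  have h1 : |u ⬝ᵥ w| ≤ Real.sqrt (u ⬝ᵥ u) * Real.sqrt (w ⬝ᵥ w) := by
    rw [← Real.sqrt_mul huu, ← Real.sqrt_sq_eq_abs]
    exact Real.sqrt_le_sqrt hcs
  have h2 : Real.sqrt (w ⬝ᵥ w) ≤ γ⁻¹ * Real.sqrt (v ⬝ᵥ v) := by
    have : Real.sqrt (γ ^ 2 * (w ⬝ᵥ w)) ≤ Real.sqrt (v ⬝ᵥ v) := Real.sqrt_le_sqrt hw2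
    rw [Real.sqrt_mul (sq_nonneg γ), Real.sqrt_sq hγ.le] at this
    calc Real.sqrt (w ⬝ᵥ w) = γ⁻¹ * (γ * Real.sqrt (w ⬝ᵥ w)) := by field_simp
      _ ≤ γ⁻¹ * Real.sqrt (v ⬝ᵥ v) := mul_le_mul_of_nonneg_left this (inv_nonneg.2 hγ.le)
  calc |u ⬝ᵥ w| ≤ Real.sqrt (u ⬝ᵥ u) * Real.sqrt (w ⬝ᵥ w) := h1
    _ ≤ Real.sqrt (u ⬝ᵥ u) * (γ⁻¹ * Real.sqrt (v ⬝ᵥ v)) := mul_le_mul_of_nonneg_left h2 (Real.sqrt_nonneg _)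
    _ = γ⁻¹ * Real.sqrt (u ⬝ᵥ u) * Real.sqrt (v ⬝ᵥ v) := by ring


end Abstract

/-! ## §2. One finite volume on `ℤ^d`: the principal submatrix of a symmetric kernel, `cosh`-weighted row sums -/

section Box

variable {d : ℕ} {T : Kernel₂ d} {s : Finset (Fin d → ℤ)} {γ κ ρ : ℝ}

/-- **SYMMETRIC FINITE COMBES–THOMAS ON THE BOX** (`inverse_decay_symm` with the `ℓ¹` lattice distance): `T` symmetric,
principal submatrix on `s` `γ`-coercive, `(cosh(κ|x−y|₁) − 1)`-weighted absolute row sums `≤ ρ < γ` ⟹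
`|T_s⁻¹(i,j)| ≤ (γ − ρ)⁻¹ e^{−κ|i−j|₁}`, constants free of `s`. [cite: CombesThomas1973, §II] [folklore] -/
theorem abs_restrict_inv_le_symm (hsym : ∀ x y, T x y = T y x) (hγρ : ρ < γ) (hκ : 0 ≤ κ)
    (hco : Coercive (Matrix.of fun i j : ↥s => T i j) γ)
    (hrow : ∀ (x : Fin d → ℤ) (t : Finset (Fin d → ℤ)), ∑ y ∈ t, |T x y| * (Real.cosh (κ * l1 (x - y)) - 1) ≤ ρ)
    (i j : ↥s) :
    |(Matrix.of fun i j : ↥s => T i j)⁻¹ i j| ≤ (γ - ρ)⁻¹ * Real.exp (-(κ * l1 ((i : Fin d → ℤ) - (j : Fin d → ℤ)))) := by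
  classical
  refine inverse_decay_symm (Matrix.of fun i j : ↥s => T i j) (fun i j : ↥s => l1 ((i : Fin d → ℤ) - (j : Fin d → ℤ)))
    (Matrix.IsSymm.ext fun i j => hsym j i) hγρ hκ hco
    (fun i j => l1_sub_comm _ _) (fun i => by simp [B12Sec2to5.l1]) (fun i j k => l1_sub_triangle _ _ _)
    (fun i => ?_) i j
  have h := hrow i s
  rw [← Finset.sum_coe_sort s (fun y => |T i y| * (Real.cosh (κ * l1 ((i : Fin d → ℤ) - y)) - 1))] at h
  simpa only [Matrix.of_apply] using h

/-- The inverse EXTENDED BY ZERO obeys the same bound everywhere. [cite: CombesThomas1973, §II] [folklore] -/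
theorem abs_extend_inv_le_symm (hsym : ∀ x y, T x y = T y x) (hγρ : ρ < γ) (hκ : 0 ≤ κ)
    (hco : Coercive (Matrix.of fun i j : ↥s => T i j) γ)
    (hrow : ∀ (x : Fin d → ℤ) (t : Finset (Fin d → ℤ)), ∑ y ∈ t, |T x y| * (Real.cosh (κ * l1 (x - y)) - 1) ≤ ρ)
    (x y : Fin d → ℤ) :
    |(if h : x ∈ s ∧ y ∈ s then (Matrix.of fun i j : ↥s => T i j)⁻¹ ⟨x, h.1⟩ ⟨y, h.2⟩ else (0 : ℝ))|
      ≤ (γ - ρ)⁻¹ * Real.exp (-(κ * l1 (x - y))) := by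
  split_ifs with h
  · exact abs_restrict_inv_le_symm hsym hγρ hκ hco hrow ⟨x, h.1⟩ ⟨y, h.2⟩
  · rw [abs_zero]
    exact mul_nonneg (inv_nonneg.2 (by linarith)) (Real.exp_pos _).le

end Box

/-! ## §3. The `ℤ^d` Green's function: the compactness mechanism with the box bound as a HYPOTHESIS, then the
symmetric headline -/

section Green

variable {d : ℕ}

/-- **THE MECHANISM, SEPARATED FROM THE ESTIMATE (with the converging subsequence exported).**  `T` of finite range `R`; finsets `bx N` exhausting `ℤ^d` on which the
principal submatrices are `γ`-coercive, `γ > 0` (used only for their invertibility); and ANY uniform bound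
`|T_{bx N}⁻¹(i,j)| ≤ C e^{−δ|i−j|₁}` on the box inverses.  Then `∃ S, T ∘ S = δ = S ∘ T ∧ Decay₂ S C δ` — gen 98's
Tychonoff-subsequence argument (`RemainderKernelGreenCoercive.exists_green_of_coercive_exhaustion`) with its Combes–Thomas
bound replaced by the hypothesis `hbd`, so that any finite-volume estimate (first-order, symmetric second-order, or other)
feeds the same limit; the subsequence `φ` and the entrywise convergence of the extended box inverses to `S` are part of the
conclusion, so that consumers can transfer further finite-sum bounds (block sums, bilinear forms) to `S`.
[cite: CombesThomas1973, §II] [folklore] -/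
theorem exists_green_of_invBound_exhaustion_tendsto {T : Kernel₂ d} {R : ℕ} {γ C δ : ℝ}
    (bx : ℕ → Finset (Fin d → ℤ)) (hbx : ∀ x, ∀ᶠ N in atTop, x ∈ bx N) (hR : HasRange T R) (hγ : 0 < γ)
    (hco : ∀ N, Coercive (Matrix.of fun i j : ↥(bx N) => T i j) γ)
    (hbd : ∀ N (i j : ↥(bx N)), |(Matrix.of fun i j : ↥(bx N) => T i j)⁻¹ i j|
      ≤ C * Real.exp (-(δ * l1 ((i : Fin d → ℤ) - (j : Fin d → ℤ))))) :
    ∃ S : Kernel₂ d, ∃ φ : ℕ → ℕ, StrictMono φ ∧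
      (∀ x y, Tendsto (fun m => (if h : x ∈ bx (φ m) ∧ y ∈ bx (φ m) then
        (Matrix.of fun i j : ↥(bx (φ m)) => T i j)⁻¹ ⟨x, h.1⟩ ⟨y, h.2⟩ else (0 : ℝ))) atTop (𝓝 (S x y))) ∧
      compKer T S = kdelta ∧ compKer S T = kdelta ∧ Decay₂ S C δ := by
  classical
  -- the extended box inverses
  set G : ℕ → Kernel₂ d := fun N x y =>
    if h : x ∈ bx N ∧ y ∈ bx N then (Matrix.of fun i j : ↥(bx N) => T i j)⁻¹ ⟨x, h.1⟩ ⟨y, h.2⟩ else 0 with hG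
  -- the compact set of kernels obeying the bound
  set B : (Fin d → ℤ) → (Fin d → ℤ) → ℝ := fun x y => |C| * Real.exp (-(δ * l1 (x - y))) with hB
  have hGB : ∀ N x y, |G N x y| ≤ B x y := by
    intro N x y
    simp only [hG, hB]
    split_ifs with h
    · exact (hbd N ⟨x, h.1⟩ ⟨y, h.2⟩).trans (mul_le_mul_of_nonneg_right (le_abs_self C) (Real.exp_pos _).le)
    · rw [abs_zero]; exact mul_nonneg (abs_nonneg C) (Real.exp_pos _).le
  have hcpt : IsCompact {K : Kernel₂ d | ∀ x, K x ∈ {r : (Fin d → ℤ) → ℝ | ∀ y, r y ∈ Set.Icc (-B x y) (B x y)}} :=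
    isCompact_pi_infinite fun x => isCompact_pi_infinite fun y => isCompact_Icc
  have hmem : ∀ N, G N ∈ {K : Kernel₂ d | ∀ x, K x ∈ {r : (Fin d → ℤ) → ℝ | ∀ y, r y ∈ Set.Icc (-B x y) (B x y)}} :=
    fun N x y => abs_le.1 (hGB N x y)
  obtain ⟨S, hS, φ, hφ, hlim⟩ := hcpt.tendsto_subseq hmem
  have hpt : ∀ x y, Tendsto (fun n => G (φ n) x y) atTop (𝓝 (S x y)) := fun x y =>
    tendsto_pi_nhds.1 (tendsto_pi_nhds.1 hlim x) y
  -- every pair of sites is eventually inside the box `bx (φ n)`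
  have hev : ∀ x z : Fin d → ℤ, ∀ᶠ n in atTop, x ∈ bx (φ n) ∧ z ∈ bx (φ n) := fun x z =>
    (hφ.tendsto_atTop.eventually (hbx x)).and (hφ.tendsto_atTop.eventually (hbx z))
  -- `0 ≤ C`: the bound at a diagonal entry of a box containing the origin
  have hC : 0 ≤ C := by
    obtain ⟨m, hm⟩ := (hev 0 0).exists
    have hb := hbd (φ m) ⟨0, hm.1⟩ ⟨0, hm.1⟩
    have e : Real.exp (-(δ * l1 (((⟨0, hm.1⟩ : ↥(bx (φ m))) : Fin d → ℤ) - ((⟨0, hm.1⟩ : ↥(bx (φ m))) : Fin d → ℤ))))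
        = 1 := by simp [B12Sec2to5.l1]
    rw [e, mul_one] at hb
    exact (abs_nonneg _).trans hb
  -- the bound passes to the limit with the constant `C` itself (each `G (φ n) x y` obeys it)
  have hlimbd : ∀ x y, |S x y| ≤ C * Real.exp (-(δ * l1 (x - y))) := by
    intro x y
    have hGC : ∀ n, |G (φ n) x y| ≤ C * Real.exp (-(δ * l1 (x - y))) := by
      intro n
      simp only [hG]
      split_ifs with h
      · exact hbd (φ n) ⟨x, h.1⟩ ⟨y, h.2⟩
      · rw [abs_zero]; exact mul_nonneg hC (Real.exp_pos _).le
    exact le_of_tendsto ((continuous_abs.tendsto _).comp (hpt x y)) (Eventually.of_forall hGC)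
  refine ⟨S, φ, hφ, fun x y => hpt x y, ?_, ?_, fun x y => ?_⟩
  · funext x z
    have h1 : Tendsto (fun n => compKer T (G (φ n)) x z) atTop (𝓝 (compKer T S x z)) := by
      simp only [compKer_eq_sum_left hR]
      exact tendsto_finsetSum _ fun y _ => (hpt y z).const_mul (T x y)
    have h2 : ∀ᶠ n in atTop, compKer T (G (φ n)) x z = kdelta x z :=
      (hev x z).mono fun n hn => compKer_extend_inv hγ (hco (φ n)) hn.1 hn.2
    exact tendsto_nhds_unique h1 (tendsto_const_nhds.congr' (h2.mono fun n hn => hn.symm))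
  · funext x z
    have h1 : Tendsto (fun n => compKer (G (φ n)) T x z) atTop (𝓝 (compKer S T x z)) := by
      simp only [compKer_eq_sum_right hR]
      exact tendsto_finsetSum _ fun y _ => (hpt x y).mul_const (T y z)
    have h2 : ∀ᶠ n in atTop, compKer (G (φ n)) T x z = kdelta x z :=
      (hev x z).mono fun n hn => compKer_extend_inv' hγ (hco (φ n)) hn.1 hn.2
    exact tendsto_nhds_unique h1 (tendsto_const_nhds.congr' (h2.mono fun n hn => hn.symm))
  · rw [neg_mul]
    exact hlimbd x y

/-- **THE MECHANISM** (existence form): same hypotheses ⟹ `∃ S, T ∘ S = δ = S ∘ T ∧ Decay₂ S C δ`.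
[cite: CombesThomas1973, §II] [folklore] -/
theorem exists_green_of_invBound_exhaustion {T : Kernel₂ d} {R : ℕ} {γ C δ : ℝ} (bx : ℕ → Finset (Fin d → ℤ))
    (hbx : ∀ x, ∀ᶠ N in atTop, x ∈ bx N) (hR : HasRange T R) (hγ : 0 < γ)
    (hco : ∀ N, Coercive (Matrix.of fun i j : ↥(bx N) => T i j) γ)
    (hbd : ∀ N (i j : ↥(bx N)), |(Matrix.of fun i j : ↥(bx N) => T i j)⁻¹ i j|
      ≤ C * Real.exp (-(δ * l1 ((i : Fin d → ℤ) - (j : Fin d → ℤ))))) :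
    ∃ S : Kernel₂ d, compKer T S = kdelta ∧ compKer S T = kdelta ∧ Decay₂ S C δ := by
  obtain ⟨S, _φ, _hφ, _hpt, h1, h2, h3⟩ := exists_green_of_invBound_exhaustion_tendsto bx hbx hR hγ hco hbd
  exact ⟨S, h1, h2, h3⟩

/-- **THE `ℤ^d` GREEN'S FUNCTION OF A SYMMETRIC COERCIVE FINITE-RANGE KERNEL ALONG AN EXHAUSTION, SECOND-ORDER RATE.**
`T` symmetric of finite range `R`; `bx N` exhausting finsets with `γ`-coercive principal submatrices; the
`(cosh(κ|x−y|₁) − 1)`-weighted absolute row sums `≤ ρ < γ` (`κ ≥ 0`).  Then `∃ S, T ∘ S = δ = S ∘ T ∧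
|S(x,y)| ≤ (γ − ρ)⁻¹ e^{−κ|x−y|₁}`. [cite: CombesThomas1973, §II] [folklore] -/
theorem exists_green_of_coercive_symm_exhaustion {T : Kernel₂ d} {R : ℕ} {γ κ ρ : ℝ} (bx : ℕ → Finset (Fin d → ℤ))
    (hbx : ∀ x, ∀ᶠ N in atTop, x ∈ bx N) (hsym : ∀ x y, T x y = T y x) (hR : HasRange T R) (hγρ : ρ < γ)
    (hκ : 0 ≤ κ) (hγ : 0 < γ) (hco : ∀ N, Coercive (Matrix.of fun i j : ↥(bx N) => T i j) γ)
    (hrow : ∀ (x : Fin d → ℤ) (t : Finset (Fin d → ℤ)), ∑ y ∈ t, |T x y| * (Real.cosh (κ * l1 (x - y)) - 1) ≤ ρ) :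
    ∃ S : Kernel₂ d, compKer T S = kdelta ∧ compKer S T = kdelta ∧ Decay₂ S (γ - ρ)⁻¹ κ :=
  exists_green_of_invBound_exhaustion bx hbx hR hγ hco
    fun N i j => abs_restrict_inv_le_symm hsym hγρ hκ (hco N) hrow i j

/-- **… EXHAUSTION BY CUBES** (all finite principal submatrices `γ`-coercive). [cite: CombesThomas1973, §II] [folklore] -/
theorem exists_green_of_coercive_symm {T : Kernel₂ d} {R : ℕ} {γ κ ρ : ℝ} (hsym : ∀ x y, T x y = T y x)
    (hR : HasRange T R) (hγρ : ρ < γ) (hκ : 0 ≤ κ) (hγ : 0 < γ)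
    (hco : ∀ s : Finset (Fin d → ℤ), Coercive (Matrix.of fun i j : ↥s => T i j) γ)
    (hrow : ∀ (x : Fin d → ℤ) (t : Finset (Fin d → ℤ)), ∑ y ∈ t, |T x y| * (Real.cosh (κ * l1 (x - y)) - 1) ≤ ρ) :
    ∃ S : Kernel₂ d, compKer T S = kdelta ∧ compKer S T = kdelta ∧ Decay₂ S (γ - ρ)⁻¹ κ :=
  exists_green_of_coercive_symm_exhaustion (fun N => Fintype.piFinset fun _ : Fin d => Finset.Icc (-(N : ℤ)) N)
    eventually_mem_cube hsym hR hγρ hκ hγ (fun _ => hco _) hrow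

/-- **… AND BLOCK-PERIODIC**: with `κ > 0` and a row bound on `T` the Green's function is jointly `n`-periodic for every
period `n` of `T` (gen 9's `IsPeriodic₂.of_inverse`) — the LABELLED INPUT `K^∞` of `EntrywiseVolumeLimit` §4 with the
second-order rate. [cite: CombesThomas1973, §II] [folklore] -/
theorem exists_green_of_coercive_symm_periodic {T : Kernel₂ d} {R : ℕ} {γ κ ρ A : ℝ} (bx : ℕ → Finset (Fin d → ℤ))
    (hbx : ∀ x, ∀ᶠ N in atTop, x ∈ bx N) (hsym : ∀ x y, T x y = T y x) (hR : HasRange T R) (hγρ : ρ < γ)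
    (hκ : 0 < κ) (hγ : 0 < γ) (hTA : RowBound T A) (hco : ∀ N, Coercive (Matrix.of fun i j : ↥(bx N) => T i j) γ)
    (hrow : ∀ (x : Fin d → ℤ) (t : Finset (Fin d → ℤ)), ∑ y ∈ t, |T x y| * (Real.cosh (κ * l1 (x - y)) - 1) ≤ ρ) :
    ∃ S : Kernel₂ d, compKer T S = kdelta ∧ compKer S T = kdelta ∧ Decay₂ S (γ - ρ)⁻¹ κ ∧
      ∀ n : ℕ, IsPeriodic₂ n T → IsPeriodic₂ n S := by
  obtain ⟨S, h1, h2, h3⟩ := exists_green_of_coercive_symm_exhaustion bx hbx hsym hR hγρ hκ.le hγ hco hrow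
  exact ⟨S, h1, h2, h3, fun n hn => IsPeriodic₂.of_inverse hn hTA (h3.rowBound hκ) h1 h2⟩

end Green

end Literature.MathematicalPhysics.QuantumFieldTheory.Balaban1983to89.Beta.RemainderKernelGreenSymm
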